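import Literature.MathematicalPhysics.StatisticalMechanics.HcpFccLatticeSumsCertificate
import Literature.MathematicalPhysics.StatisticalMechanics.HcpFccEnergySeries

/-!
# Lennard-Jones: the relaxed hcp crystal lies strictly below the relaxed fcc lattice (certified)

**Headline** (`lennardJones_hcp_below_fcc`): there is an hcp crystal `hcp(a₀, a₀√(2/3))` (ideal layer
ratio, optimal scale) whose Lennard-Jones energy per particle (tree normalisation `V_LJ(1) = −1/12`,
`lennardJones`) satisfies `e(hcp(a₀,h₀)) + 723/10⁷ ≤ e(fcc(a, a√(2/3)))` for EVERY cubic fcc lattice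
(`a ≠ 0`); and conversely some cubic fcc lattice is within `726/10⁷` of every ideal hcp crystal
(`lennardJones_fcc_near_hcp`).  Equivalently (`lennardJones_fcc_sub_hcp_optimalEnergy`): the optimal
energies `e* = −L₆²/(24 L₁₂)` of the two one-parameter families differ by
`7.23·10⁻⁵ ≤ e*_fcc − e*_hcp ≤ 7.26·10⁻⁵` (relative size `≈ 1.0·10⁻⁴` of `e* ≈ −0.7175`).  Since the
two-parameter hcp family `hcp(a, h)` contains the ideal one, its infimum (the tree's `HcpFamilyMin`
of crux `StrictSplittingRule`) is below the cubic fcc family by at least the same margin — the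
certified form of the kill criterion "e_fcc ≤ e_hcp" of the certificate routes (item
stmt-AtomisticToContinuum-0670, FreeSplittingCertificates / PolytypePerturbativeCertificate).

The comparison is classical as NON-CERTIFIED numerics (Kihara–Koba 1952; Stillinger 2001, §II;
Schwerdtfeger–Burrows–Smits 2021: `L₆ = 14.45392 / 14.45490`, `L₁₂ = 12.13188 / 12.13229`); here it
is a theorem: kernel-evaluated box sums with explicit power-law tail bounds, organised so that only
the inter-stacking DIFFERENCES (registry couplings, `≈ 10⁻³`) need high accuracy
(`HcpFccLatticeSums*.lean`).  Not covered: rhombohedrally strained fcc (`h ≠ a√(2/3)`), other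
polytypes, zero-point / thermal effects.

## References
* F. H. Stillinger, *Lattice sums and their phase diagram implications for the classical
  Lennard-Jones model*, J. Chem. Phys. 115 (2001) 5208–5212, §II.
* P. Schwerdtfeger, A. Burrows, O. R. Smits, *The Lennard-Jones potential revisited*, J. Phys.
  Chem. A 125 (2021) 3037–3057 (arXiv:2012.05413, p. 8: `L₆, L₁₂` of fcc and hcp).
-/

noncomputable section

namespace Literature.MathematicalPhysics.StatisticalMechanics

open Finset StackingSums

/-- `√(2/3) ≠ 0`. [folklore] -/
theorem sqrt_two_thirds_ne_zero : Real.sqrt (2 / 3) ≠ 0 := (Real.sqrt_pos.2 (by norm_num)).ne'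

/-- **The gap between the optimal energies (certified)**: with
`e*_fcc := −(L₆ᶠᶜᶜ)²/(24 L₁₂ᶠᶜᶜ)` (the minimum over the scale of the Lennard-Jones energy per particle
of the cubic fcc lattice) and `e*_hcp := −(L₆ʰᶜᵖ)²/(24 L₁₂ʰᶜᵖ)` (that of the ideal hcp,
`c² = 2/3`): `7.23·10⁻⁵ ≤ e*_fcc − e*_hcp ≤ 7.26·10⁻⁵` (tree normalisation `V_LJ(1) = −1/12`;
Stillinger 2001 / Schwerdtfeger–Burrows–Smits 2021 print the non-certified lattice sums
`L₆ = 14.45392, 14.45490`, `L₁₂ = 12.13188, 12.13229`). [cite: Stillinger2001, §II] -/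
theorem lennardJones_fcc_sub_hcp_optimalEnergy :
    (723 / 10 ^ 7 : ℝ) ≤
      -(fccInvPowSum 3 (Real.sqrt (2 / 3)) ^ 2 / (24 * fccInvPowSum 6 (Real.sqrt (2 / 3)))) -
        -(hcpInvPowSum 3 (Real.sqrt (2 / 3)) ^ 2 / (24 * hcpInvPowSum 6 (Real.sqrt (2 / 3)))) ∧
    -(fccInvPowSum 3 (Real.sqrt (2 / 3)) ^ 2 / (24 * fccInvPowSum 6 (Real.sqrt (2 / 3)))) -
        -(hcpInvPowSum 3 (Real.sqrt (2 / 3)) ^ 2 / (24 * hcpInvPowSum 6 (Real.sqrt (2 / 3)))) ≤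
      726 / 10 ^ 7 := by
  obtain ⟨h1, h2⟩ := hcp_fcc_shapeGap
  have hy : 0 < hcpInvPowSum 6 (Real.sqrt (2 / 3)) := by linarith [hcpInvPowSum_six_bounds.1]
  have hv : 0 < fccInvPowSum 6 (Real.sqrt (2 / 3)) := by linarith [fccInvPowSum_six_bounds.1]
  have e : -(fccInvPowSum 3 (Real.sqrt (2 / 3)) ^ 2 / (24 * fccInvPowSum 6 (Real.sqrt (2 / 3)))) -
      -(hcpInvPowSum 3 (Real.sqrt (2 / 3)) ^ 2 / (24 * hcpInvPowSum 6 (Real.sqrt (2 / 3)))) =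
      (hcpInvPowSum 3 (Real.sqrt (2 / 3)) ^ 2 / hcpInvPowSum 6 (Real.sqrt (2 / 3)) -
        fccInvPowSum 3 (Real.sqrt (2 / 3)) ^ 2 / fccInvPowSum 6 (Real.sqrt (2 / 3))) / 24 := by
    field_simp
    ring
  rw [e]
  constructor
  · rw [le_div_iff₀ (by norm_num : (0:ℝ) < 24)]; norm_num at h1 ⊢; linarith
  · rw [div_le_iff₀ (by norm_num : (0:ℝ) < 24)]; norm_num at h2 ⊢; linarith

/-- **The cubic fcc family is bounded below by its explicit optimum**: for every `a ≠ 0` and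
`h = a √(2/3)` (cubic fcc with nearest-neighbour distance `|a|`),
`−(L₆ᶠᶜᶜ)²/(24 L₁₂ᶠᶜᶜ) ≤ e(fcc(a, h))`. [cite: Stillinger2001, §II] -/
theorem lennardJones_fcc_energyPerParticle_ge {a h : ℝ} (ha : a ≠ 0) (hh : h ≠ 0)
    (hha : h = a * Real.sqrt (2 / 3)) :
    -(fccInvPowSum 3 (Real.sqrt (2 / 3)) ^ 2 / (24 * fccInvPowSum 6 (Real.sqrt (2 / 3)))) ≤
      (fccPeriodicConfiguration ha hh).energyPerParticle lennardJones := by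
  subst hha
  rw [fcc_lennardJones_energyPerParticle ha sqrt_two_thirds_ne_zero]
  exact lj_scale_energy_ge _ (by linarith [fccInvPowSum_six_bounds.1]) a

/-- **… and the optimum is attained**: some `a₁ > 0` has
`e(fcc(a₁, a₁√(2/3))) = −(L₆ᶠᶜᶜ)²/(24 L₁₂ᶠᶜᶜ)`. [cite: Stillinger2001, §II] -/
theorem lennardJones_fcc_energyPerParticle_attained :
    ∃ (a : ℝ) (ha : a ≠ 0), 0 < a ∧
      (fccPeriodicConfiguration ha (mul_ne_zero ha sqrt_two_thirds_ne_zero)).energyPerParticle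
          lennardJones =
        -(fccInvPowSum 3 (Real.sqrt (2 / 3)) ^ 2 / (24 * fccInvPowSum 6 (Real.sqrt (2 / 3)))) := by
  obtain ⟨a, ha, he⟩ := lj_scale_energy_attained (x := fccInvPowSum 3 (Real.sqrt (2 / 3)))
    (y := fccInvPowSum 6 (Real.sqrt (2 / 3))) (by linarith [fccInvPowSum_three_bounds.1])
    (by linarith [fccInvPowSum_six_bounds.1])
  refine ⟨a, ha.ne', ha, ?_⟩
  rw [fcc_lennardJones_energyPerParticle ha.ne' sqrt_two_thirds_ne_zero]
  exact he

/-- **The ideal hcp family is bounded below by its explicit optimum**: for every `a ≠ 0` and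
`h = a √(2/3)`, `−(L₆ʰᶜᵖ)²/(24 L₁₂ʰᶜᵖ) ≤ e(hcp(a, h))`. [cite: Stillinger2001, §II] -/
theorem lennardJones_hcp_energyPerParticle_ge {a h : ℝ} (ha : a ≠ 0) (hh : h ≠ 0)
    (hha : h = a * Real.sqrt (2 / 3)) :
    -(hcpInvPowSum 3 (Real.sqrt (2 / 3)) ^ 2 / (24 * hcpInvPowSum 6 (Real.sqrt (2 / 3)))) ≤
      (hcpPeriodicConfiguration ha hh).energyPerParticle lennardJones := by
  subst hha
  rw [hcp_lennardJones_energyPerParticle ha sqrt_two_thirds_ne_zero]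
  exact lj_scale_energy_ge _ (by linarith [hcpInvPowSum_six_bounds.1]) a

/-- **… and the ideal-hcp optimum is attained**: some `a₀ > 0` has
`e(hcp(a₀, a₀√(2/3))) = −(L₆ʰᶜᵖ)²/(24 L₁₂ʰᶜᵖ)`. [cite: Stillinger2001, §II] -/
theorem lennardJones_hcp_energyPerParticle_attained :
    ∃ (a : ℝ) (ha : a ≠ 0), 0 < a ∧
      (hcpPeriodicConfiguration ha (mul_ne_zero ha sqrt_two_thirds_ne_zero)).energyPerParticle
          lennardJones =
        -(hcpInvPowSum 3 (Real.sqrt (2 / 3)) ^ 2 / (24 * hcpInvPowSum 6 (Real.sqrt (2 / 3)))) := by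
  obtain ⟨a, ha, he⟩ := lj_scale_energy_attained (x := hcpInvPowSum 3 (Real.sqrt (2 / 3)))
    (y := hcpInvPowSum 6 (Real.sqrt (2 / 3))) (by linarith [hcpInvPowSum_three_bounds.1])
    (by linarith [hcpInvPowSum_six_bounds.1])
  refine ⟨a, ha.ne', ha, ?_⟩
  rw [hcp_lennardJones_energyPerParticle ha.ne' sqrt_two_thirds_ne_zero]
  exact he

/-- **LENNARD-JONES: RELAXED hcp LIES STRICTLY BELOW RELAXED fcc (certified).**
There is an hcp crystal `hcp(a₀, h₀)` (ideal ratio `h₀ = a₀√(2/3)`, optimal scale `a₀ > 0`) whose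
Lennard-Jones energy per particle undercuts that of EVERY cubic fcc lattice `fcc(a, a√(2/3))`,
`a ≠ 0`, by at least `7.23·10⁻⁵` (in the tree's units `V_LJ(1) = −1/12`; `≈ 1.0·10⁻⁴` of the
energy `≈ −0.7175`):
`e(hcp(a₀, h₀)) + 723/10⁷ ≤ e(fcc(a, h))` whenever `h = a√(2/3)`.
A fortiori the infimum over the whole two-parameter hcp family `hcp(a', h')` is below the cubic fcc
family by the same margin.  This is the certified form of the classical lattice-sum comparison
"hcp < fcc for the 12-6 potential" (Kihara–Koba 1952; Stillinger 2001; Schwerdtfeger–Burrows–Smits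
2021), here a THEOREM: kernel-evaluated box sums + explicit tail bounds
(`HcpFccLatticeSums*.lean`). [cite: Stillinger2001, §II] -/
theorem lennardJones_hcp_below_fcc :
    ∃ (a₀ h₀ : ℝ) (ha₀ : a₀ ≠ 0) (hh₀ : h₀ ≠ 0), 0 < a₀ ∧ h₀ = a₀ * Real.sqrt (2 / 3) ∧
      ∀ (a h : ℝ) (ha : a ≠ 0) (hh : h ≠ 0), h = a * Real.sqrt (2 / 3) →
        (hcpPeriodicConfiguration ha₀ hh₀).energyPerParticle lennardJones + 723 / 10 ^ 7 ≤
          (fccPeriodicConfiguration ha hh).energyPerParticle lennardJones := by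
  obtain ⟨a₀, ha₀, ha₀pos, he₀⟩ := lennardJones_hcp_energyPerParticle_attained
  refine ⟨a₀, a₀ * Real.sqrt (2 / 3), ha₀, mul_ne_zero ha₀ sqrt_two_thirds_ne_zero, ha₀pos, rfl, ?_⟩
  intro a h ha hh hha
  rw [he₀]
  have hge := lennardJones_fcc_energyPerParticle_ge ha hh hha
  have hgap := lennardJones_fcc_sub_hcp_optimalEnergy.1
  linarith

/-- **Two-sided form**: the optimal cubic-fcc energy exceeds the optimal ideal-hcp energy by at most
`7.26·10⁻⁵`: some cubic fcc lattice comes within `726/10⁷` of `e(hcp(a₀, h₀))` for every ideal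
hcp crystal `hcp(a₀, a₀√(2/3))`. [cite: Stillinger2001, §II] -/
theorem lennardJones_fcc_near_hcp :
    ∃ (a₁ h₁ : ℝ) (ha₁ : a₁ ≠ 0) (hh₁ : h₁ ≠ 0), 0 < a₁ ∧ h₁ = a₁ * Real.sqrt (2 / 3) ∧
      ∀ (a h : ℝ) (ha : a ≠ 0) (hh : h ≠ 0), h = a * Real.sqrt (2 / 3) →
        (fccPeriodicConfiguration ha₁ hh₁).energyPerParticle lennardJones ≤
          (hcpPeriodicConfiguration ha hh).energyPerParticle lennardJones + 726 / 10 ^ 7 := by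
  obtain ⟨a₁, ha₁, ha₁pos, he₁⟩ := lennardJones_fcc_energyPerParticle_attained
  refine ⟨a₁, a₁ * Real.sqrt (2 / 3), ha₁, mul_ne_zero ha₁ sqrt_two_thirds_ne_zero, ha₁pos, rfl, ?_⟩
  intro a h ha hh hha
  rw [he₁]
  have hge := lennardJones_hcp_energyPerParticle_ge ha hh hha
  have hgap := lennardJones_fcc_sub_hcp_optimalEnergy.2
  linarith

end Literature.MathematicalPhysics.StatisticalMechanics

end
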